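import Summits.HodgeConjecture.HodgeConjecture.Theorems.NikulinTwinTransportHodgeSimilitudeAlgebraicLattice
import Literature.AlgebraicGeometry.Surfaces.K3PeriodSurjectivityProofs

/-!
# Route NikulinTwinTransport · crux `HodgeSimilitudeAlgebraic` (stmt-HodgeConjecture-13676) —
# line `kummer-bkr-quaternion-carrier`, stub `stub_kummerSimilitude` (the Kummer-shaped similitude)

Stub 2b of the line's skeleton: given a prime `q`, a code matrix `Mc ∈ M₁₆(ℤ)` (`Mcᵀ Mc = q·1`) and ANY
Kummer frame `(u, e)` of the K3 lattice `Λ = (K3Index → ℤ, k3Gram)` (only the three Gram clauses of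
`KummerFrame` are used: `u` a standard basis of a `U(2)³`, `e` sixteen pairwise orthogonal `(−2)`-vectors
orthogonal to `u`), there are endomorphisms `M, N` of `Λ_ℂ` with `M` KUMMER-SHAPED on the frame
(`u k 0 ↦ u k 0`, `u k 1 ↦ q·u k 1`, `e a ↦ Σ_b Mc_{ba} e b`) and `(M, N)` a rational `q`-similitude pair
(`M, N` defined over `ℚ`, `MN = NM = 1`, `(Ma.Mb) = q (a.b)`) — the input of `anchorAt_of_twinTransport`.

## Mathematics (block linear algebra over `ℚ`, then cast to `ℂ` as in `exists_ratSimilitude_k3Lattice`)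

Index the frame by `J = (Fin 2 × Fin 3) ⊕ Fin 16` (`(s, k) ↦ u k s`, `a ↦ e a`); let `F : Matrix K3Index J ℚ`
have the frame vectors as columns and `G = k3Gram ⊗ ℚ`. The Gram clauses say `Fᵀ G F = Gfr := GU ⊕ (−2·1₁₆)`,
`GU ((s,k),(t,l)) = [k = l ∧ s ≠ t]·2`; `Gfr` has the explicit inverse `Gfr' = ¼ GU ⊕ (−½·1₁₆)`, so
`F' := Gfr' Fᵀ G` satisfies `F' F = 1`, hence `F F' = 1` (`card J = 22 = card K3Index`,
`Matrix.mul_eq_one_comm_of_equiv`). Put `D := diag(d) ⊕ Mc` (`d (0,k) = 1`, `d (1,k) = q`) and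
`D' := diag(d)⁻¹ ⊕ q⁻¹ Mcᵀ`; then `D' D = D D' = 1` and `Dᵀ Gfr D = q·Gfr` blockwise. With `A := F D F'`,
`B := F D' F'`: `A B = B A = 1`, `A F = F D` (the Kummer shape, read off column by column) and
`Aᵀ G A = F'ᵀ Dᵀ (Fᵀ G F) D F' = q·F'ᵀ Gfr F' = q·(F F')ᵀ G (F F') = q·G`. Finally `M := A ⊗ ℂ`, `N := B ⊗ ℂ`.
Sources: folklore (Nikulin 1975 / Morrison 1984 §3 for the Kummer lattice; elementary algebra). Patterns:
`NikulinTwinTransport{HodgeSimilitudeAlgebraic,TwinSimilitudeAlgebraic}Lattice` (block algebra, casts).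
-/

noncomputable section

open scoped Matrix
open Literature.AlgebraicGeometry.Surfaces

namespace Summit.HodgeConjecture.HodgeConjecture.Theorems.NikulinTwinTransport.KummerBkrQuaternionCarrier

/-! ## Local notations of the line (bodies verbatim from the skeleton) -/

/-- `SimilPair[c, M, N]`: `M` is a `ℂ`-linear `c`-similitude of `(Λ_ℂ, k3Form)` defined over `ℚ` with a
two-sided inverse `N` defined over `ℚ` (the hypothesis bundle of `anchorAt_of_twinTransport`). Local notation only. -/
local notation3 (prettyPrint := false) "SimilPair[" c ", " M ", " N "]" =>
  ((∀ v : K3Index → ℤ, ∃ w : K3Index → ℚ, M (fun i => (v i : ℂ)) = fun i => (w i : ℂ)) ∧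
    (∀ v : K3Index → ℤ, ∃ w : K3Index → ℚ, N (fun i => (v i : ℂ)) = fun i => (w i : ℂ)) ∧
    M * N = 1 ∧ N * M = 1 ∧ (∀ a b, k3Form (M a) (M b) = c * k3Form a b))

/-- `zC[v]`: a lattice vector `v ∈ Λ = ℤ^{22}` viewed in `Λ_ℂ`. Local notation only. -/
local notation3 (prettyPrint := false) "zC[" v "]" => (fun i : K3Index => (((v : K3Index → ℤ) i : ℤ) : ℂ))

/-- `IntForm[v, w] = vᵀ Λ w`, the integral K3 lattice form (as in `PeriodPt`). Local notation only. -/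
local notation3 (prettyPrint := false) "IntForm[" v ", " w "]" =>
  (∑ i : K3Index, ∑ j : K3Index, (v : K3Index → ℤ) i * k3Gram i j * (w : K3Index → ℤ) j)

/-- `Bit[k, a] ∈ {0, 1} ⊂ ℤ`: the `k`-th binary digit of `a : Fin 16` (`Fin 16 = 𝔽₂⁴`). Local notation only. -/
local notation3 (prettyPrint := false) "Bit[" k ", " a "]" =>
  (((Fin.val (a : Fin 16) / 2 ^ Fin.val (k : Fin 4)) % 2 : ℕ) : ℤ)

/-- `AffineMod2[y]`: `y : Fin 16 → ℤ` reduces mod 2 to a codeword of `RM(1,4)`. Local notation only. -/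
local notation3 (prettyPrint := false) "AffineMod2[" y "]" =>
  (∃ (c₀ : ℤ) (c : Fin 4 → ℤ), ∀ a : Fin 16,
    (2 : ℤ) ∣ (y : Fin 16 → ℤ) a - c₀ - ∑ k : Fin 4, c k * Bit[k, a])

/-- `CodeMatrix[q, Mc]`: `Mcᵀ Mc = q·1` and `Mc mod 2` preserves `RM(1,4)`. Local notation only. -/
local notation3 (prettyPrint := false) "CodeMatrix[" q ", " Mc "]" =>
  (Matrix.transpose Mc * Mc = ((q : ℕ) : ℤ) • (1 : Matrix (Fin 16) (Fin 16) ℤ) ∧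
    ∀ y : Fin 16 → ℤ, AffineMod2[y] → AffineMod2[Matrix.mulVec Mc y])

/-- `KummerFrame[u, e]`: a KUMMER FRAME of the K3 lattice — `u k s` a standard basis of a `U(2)³`, `e a`
sixteen pairwise orthogonal `(−2)`-vectors orthogonal to `u`, the `RM(1,4)` half-sums integral, the
saturation of `⟨e⟩` glued exactly by `RM(1,4)` (Nikulin 1975). Local notation only. -/
local notation3 (prettyPrint := false) "KummerFrame[" u ", " e "]" =>
  ((∀ (k l : Fin 3) (s t : Fin 2),
      IntForm[(u : Fin 3 → Fin 2 → K3Index → ℤ) k s, u l t] = if k = l ∧ s ≠ t then 2 else 0) ∧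
    (∀ (k : Fin 3) (s : Fin 2) (a : Fin 16), IntForm[u k s, (e : Fin 16 → K3Index → ℤ) a] = 0) ∧
    (∀ a b : Fin 16, IntForm[e a, e b] = if a = b then -2 else 0) ∧
    (∀ k : Fin 4, ∃ g : K3Index → ℤ,
      2 • g = ∑ a : Fin 16, (if (Fin.val a / 2 ^ Fin.val k) % 2 = 1 then e a else 0)) ∧
    (∃ g : K3Index → ℤ, 2 • g = ∑ a : Fin 16, e a) ∧
    (∀ (v : K3Index → ℤ) (y : Fin 16 → ℤ), 2 • v = ∑ a : Fin 16, y a • e a → AffineMod2[y]))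

/-- `KummerShape[q, u, e, Mc, M]`: `M` is KUMMER-SHAPED for the prime `q` on the frame `(u, e)` —
`⊕³ diag(1, q)` on `u` and the code matrix `Mc` on `e` (`M e_a = Σ_b Mc_{ba} e_b`). Local notation only. -/
local notation3 (prettyPrint := false) "KummerShape[" q ", " u ", " e ", " Mc ", " M "]" =>
  ((∀ k : Fin 3, M zC[(u : Fin 3 → Fin 2 → K3Index → ℤ) k 0] = zC[u k 0] ∧
      M zC[u k 1] = ((q : ℕ) : ℂ) • zC[u k 1]) ∧
    (∀ a : Fin 16, M zC[(e : Fin 16 → K3Index → ℤ) a] =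
      ∑ b : Fin 16, (((Mc : Matrix (Fin 16) (Fin 16) ℤ) b a : ℤ) : ℂ) • zC[e b]))

/-! ## Local notations of this file (explicit rational matrices; no definitions) -/

/-- `JJ = (Fin 2 × Fin 3) ⊕ Fin 16`, the index type of a Kummer frame (`(s, k) ↦ u k s`, `a ↦ e a`).
Local notation only. -/
local notation3 (prettyPrint := false) "JJ" => (Fin 2 × Fin 3 ⊕ Fin 16)

/-- `Gq = Λ ⊗ ℚ`, the rational K3 Gram matrix. Local notation only. -/
local notation3 (prettyPrint := false) "Gq" => (k3Gram.map (Int.cast : ℤ → ℚ) : Matrix K3Index K3Index ℚ)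

/-- `GU`: three copies of `U(2)` indexed by `Fin 2 × Fin 3`, `((s,k),(t,l)) ↦ [k = l ∧ s ≠ t]·2`.
Local notation only. -/
local notation3 (prettyPrint := false) "GU" =>
  (Matrix.of fun (p p' : Fin 2 × Fin 3) => if p.2 = p'.2 ∧ p.1 ≠ p'.1 then (2 : ℚ) else 0)

/-- `GU' = GU⁻¹ = ¼ GU`. Local notation only. -/
local notation3 (prettyPrint := false) "GU'" =>
  (Matrix.of fun (p p' : Fin 2 × Fin 3) => if p.2 = p'.2 ∧ p.1 ≠ p'.1 then (2 : ℚ)⁻¹ else 0)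

/-- `Gfr = GU ⊕ (−2·1₁₆)`, the Gram matrix of a Kummer frame. Local notation only. -/
local notation3 (prettyPrint := false) "Gfr" =>
  (Matrix.fromBlocks GU 0 0 ((-2 : ℚ) • (1 : Matrix (Fin 16) (Fin 16) ℚ)) : Matrix JJ JJ ℚ)

/-- `Gfr' = Gfr⁻¹`. Local notation only. -/
local notation3 (prettyPrint := false) "Gfr'" =>
  (Matrix.fromBlocks GU' 0 0 ((-2 : ℚ)⁻¹ • (1 : Matrix (Fin 16) (Fin 16) ℚ)) : Matrix JJ JJ ℚ)

/-- `DU[r] = diag(d)`, `d (0, k) = 1`, `d (1, k) = r`: the shape `⊕³ diag(1, r)`. Local notation only. -/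
local notation3 (prettyPrint := false) "DU[" r "]" =>
  (Matrix.diagonal fun p : Fin 2 × Fin 3 => if p.1 = 0 then (1 : ℚ) else (r : ℚ))

/-- `DU'[r] = DU[r]⁻¹`. Local notation only. -/
local notation3 (prettyPrint := false) "DU'[" r "]" =>
  (Matrix.diagonal fun p : Fin 2 × Fin 3 => if p.1 = 0 then (1 : ℚ) else (r : ℚ)⁻¹)

/-- `McQ[Mc] = Mc ⊗ ℚ` (cast along the ring homomorphism `ℤ → ℚ`). Local notation only. -/
local notation3 (prettyPrint := false) "McQ[" Mc "]" =>
  ((Mc : Matrix (Fin 16) (Fin 16) ℤ).map (Int.castRingHom ℚ : ℤ →+* ℚ) : Matrix (Fin 16) (Fin 16) ℚ)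

/-- `DD[r, Mc] = DU[r] ⊕ Mc`: the Kummer shape in frame coordinates. Local notation only. -/
local notation3 (prettyPrint := false) "DD[" r ", " Mc "]" =>
  (Matrix.fromBlocks DU[r] 0 0 McQ[Mc] : Matrix JJ JJ ℚ)

/-- `DD'[r, Mc] = DU[r]⁻¹ ⊕ r⁻¹ Mcᵀ`, the inverse of `DD[r, Mc]` when `Mcᵀ Mc = r`. Local notation only. -/
local notation3 (prettyPrint := false) "DD'[" r ", " Mc "]" =>
  (Matrix.fromBlocks DU'[r] 0 0 ((r : ℚ)⁻¹ • (McQ[Mc])ᵀ) : Matrix JJ JJ ℚ)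

/-- `FU[u]`: the `u`-vectors of a frame as rational columns, column `(s, k)` = `u k s`. Local notation only. -/
local notation3 (prettyPrint := false) "FU[" u "]" =>
  (Matrix.of fun (i : K3Index) (p : Fin 2 × Fin 3) =>
    (((u : Fin 3 → Fin 2 → K3Index → ℤ) p.2 p.1 i : ℤ) : ℚ))

/-- `FE[e]`: the `e`-vectors of a frame as rational columns. Local notation only. -/
local notation3 (prettyPrint := false) "FE[" e "]" =>
  (Matrix.of fun (i : K3Index) (a : Fin 16) => (((e : Fin 16 → K3Index → ℤ) a i : ℤ) : ℚ))

/-- `FF[u, e] = (FU | FE)`, the frame matrix (columns = the 22 frame vectors). Local notation only. -/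
local notation3 (prettyPrint := false) "FF[" u ", " e "]" =>
  (Matrix.fromCols FU[u] FE[e] : Matrix K3Index JJ ℚ)

/-- `FF'[u, e] = Gfr⁻¹ FFᵀ G`, the inverse of the frame matrix. Local notation only. -/
local notation3 (prettyPrint := false) "FF'[" u ", " e "]" =>
  (Gfr' * (FF[u, e])ᵀ * Gq : Matrix JJ K3Index ℚ)

/-! ## The Gram matrix of a Kummer frame and the inverse of the frame matrix -/

/-- `(Xᵀ G Y)_{jj'} = Σ_i Σ_i' X_{ij} G_{ii'} Y_{i'j'}`. [folklore] -/
theorem frameGram_apply {m n : Type*} (X : Matrix K3Index m ℚ) (Y : Matrix K3Index n ℚ) (j : m)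
    (j' : n) : (Xᵀ * Gq * Y) j j' = ∑ i, ∑ i', X i j * Gq i i' * Y i' j' := by
  simp only [Matrix.mul_apply, Matrix.transpose_apply, Finset.sum_mul]
  rw [Finset.sum_comm]

/-- The integral lattice form, cast to `ℚ`, is the double sum against `Λ ⊗ ℚ`. [folklore] -/
theorem intForm_ratCast (v w : K3Index → ℤ) :
    ((IntForm[v, w] : ℤ) : ℚ) = ∑ i, ∑ i', (v i : ℚ) * Gq i i' * (w i' : ℚ) := by
  simp only [Int.cast_sum, Int.cast_mul, Matrix.map_apply]

/-- The integral lattice form is symmetric. [folklore] -/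
theorem intForm_comm (v w : K3Index → ℤ) : IntForm[v, w] = IntForm[w, v] := by
  rw [Finset.sum_comm]
  refine Finset.sum_congr rfl fun i _ => Finset.sum_congr rfl fun j _ => ?_
  rw [k3Gram_apply_comm j i]
  ring

/-- **The Gram matrix of a Kummer frame**: the first three clauses of `KummerFrame` say, blockwise,
`FFᵀ G FF = Gfr = U(2)³ ⊕ (−2·1₁₆)`. [folklore] -/
theorem frame_gram (u : Fin 3 → Fin 2 → K3Index → ℤ) (e : Fin 16 → K3Index → ℤ)
    (hU : ∀ (k l : Fin 3) (s t : Fin 2), IntForm[u k s, u l t] = if k = l ∧ s ≠ t then 2 else 0)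
    (hUE : ∀ (k : Fin 3) (s : Fin 2) (a : Fin 16), IntForm[u k s, e a] = 0)
    (hE : ∀ a b : Fin 16, IntForm[e a, e b] = if a = b then -2 else 0) :
    (FF[u, e])ᵀ * Gq * FF[u, e] = Gfr := by
  rw [Matrix.transpose_fromCols, Matrix.fromRows_mul, Matrix.fromRows_mul_fromCols]
  congr 1
  · ext ⟨s, k⟩ ⟨t, l⟩
    rw [frameGram_apply]
    simp only [Matrix.of_apply]
    rw [← intForm_ratCast (u k s) (u l t), hU]
    push_cast
    rfl
  · ext ⟨s, k⟩ a
    rw [frameGram_apply]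
    simp only [Matrix.of_apply, Matrix.zero_apply]
    rw [← intForm_ratCast (u k s) (e a), hUE, Int.cast_zero]
  · ext a ⟨s, k⟩
    rw [frameGram_apply]
    simp only [Matrix.of_apply, Matrix.zero_apply]
    rw [← intForm_ratCast (e a) (u k s), intForm_comm, hUE, Int.cast_zero]
  · ext a b
    rw [frameGram_apply]
    simp only [Matrix.of_apply, Matrix.smul_apply, Matrix.one_apply, smul_eq_mul, mul_ite, mul_one,
      mul_zero]
    rw [← intForm_ratCast (e a) (e b), hE]
    push_cast
    rfl

/-- `Gfr' Gfr = 1` (`GU' GU = 1` by a finite computation, `(−½)(−2) = 1`). [folklore] -/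
theorem kGramInv_mul : Gfr' * Gfr = 1 := by
  rw [fromBlocks_diag_mul, smul_mul_assoc, Matrix.one_mul, smul_smul,
    inv_mul_cancel₀ (by norm_num : (-2 : ℚ) ≠ 0), one_smul, ← Matrix.fromBlocks_one]
  congr 1
  ext ⟨s, k⟩ ⟨t, l⟩
  simp only [Matrix.mul_apply, Fintype.sum_prod_type, Matrix.of_apply, Matrix.one_apply, Prod.mk.injEq,
    Fin.sum_univ_two]
  fin_cases s <;> fin_cases t <;> simp [Finset.sum_ite_eq']

/-- `FF' FF = Gfr' (FFᵀ G FF) = 1`. [folklore] -/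
theorem frameInv_mul_frame (u : Fin 3 → Fin 2 → K3Index → ℤ) (e : Fin 16 → K3Index → ℤ)
    (hGram : (FF[u, e])ᵀ * Gq * FF[u, e] = Gfr) : FF'[u, e] * FF[u, e] = 1 :=
  calc FF'[u, e] * FF[u, e] = Gfr' * ((FF[u, e])ᵀ * Gq * FF[u, e]) := by simp only [Matrix.mul_assoc]
    _ = 1 := by rw [hGram, kGramInv_mul]

/-- `FF FF' = 1` (a one-sided inverse of a square matrix is two-sided; `card JJ = 22`). [folklore] -/
theorem frame_mul_frameInv (u : Fin 3 → Fin 2 → K3Index → ℤ) (e : Fin 16 → K3Index → ℤ)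
    (hGram : (FF[u, e])ᵀ * Gq * FF[u, e] = Gfr) : FF[u, e] * FF'[u, e] = 1 :=
  (Matrix.mul_eq_one_comm_of_equiv (Fintype.equivOfCardEq rfl : JJ ≃ K3Index)).mp
    (frameInv_mul_frame u e hGram)

/-! ## The shape `DD = DU ⊕ Mc`, its inverse, and `DDᵀ Gfr DD = q · Gfr` -/

/-- `DU'[r] DU[r] = 1`. [folklore] -/
theorem kDUInv_mul (r : ℚ) (hr : r ≠ 0) : DU'[r] * DU[r] = 1 := by
  rw [Matrix.diagonal_mul_diagonal, ← Matrix.diagonal_one]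
  congr 1
  funext p
  split_ifs <;> simp [hr]

/-- `DU[r] DU'[r] = 1`. [folklore] -/
theorem kDU_mul_inv (r : ℚ) (hr : r ≠ 0) : DU[r] * DU'[r] = 1 := by
  rw [Matrix.diagonal_mul_diagonal, ← Matrix.diagonal_one]
  congr 1
  funext p
  split_ifs <;> simp [hr]

/-- `DU[r]ᵀ GU DU[r] = r · GU` (`diag(1, r) U(2) diag(1, r) = r · U(2)` on each plane). [folklore] -/
theorem kDU_conj (r : ℚ) : (DU[r])ᵀ * GU * DU[r] = r • GU := by
  rw [Matrix.diagonal_transpose]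
  ext ⟨s, k⟩ ⟨t, l⟩
  simp only [Matrix.mul_diagonal, Matrix.diagonal_mul, Matrix.of_apply, Matrix.smul_apply, smul_eq_mul]
  fin_cases s <;> fin_cases t <;> simp [mul_comm]

section Code

variable {q : ℕ} {Mc : Matrix (Fin 16) (Fin 16) ℤ}
  (hMc : Matrix.transpose Mc * Mc = ((q : ℕ) : ℤ) • (1 : Matrix (Fin 16) (Fin 16) ℤ))
include hMc

/-- `Mcᵀ Mc = q` over `ℚ`. [folklore] -/
theorem codeQ_gram : (McQ[Mc])ᵀ * McQ[Mc] = (q : ℚ) • (1 : Matrix (Fin 16) (Fin 16) ℚ) := by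
  rw [← Matrix.transpose_map, ← Matrix.map_mul, hMc, Matrix.smul_one_eq_diagonal,
    Matrix.diagonal_map (map_zero _), Matrix.smul_one_eq_diagonal]
  simp

/-- `(q⁻¹ Mcᵀ) Mc = 1`. [folklore] -/
theorem codeQ_inv_mul (hq : (q : ℚ) ≠ 0) : ((q : ℚ)⁻¹ • (McQ[Mc])ᵀ) * McQ[Mc] = 1 := by
  rw [smul_mul_assoc, codeQ_gram hMc, smul_smul, inv_mul_cancel₀ hq, one_smul]

/-- `DD' DD = 1`. [folklore] -/
theorem kDInv_mul (hq : (q : ℚ) ≠ 0) : DD'[(q : ℚ), Mc] * DD[(q : ℚ), Mc] = 1 := by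
  rw [fromBlocks_diag_mul, kDUInv_mul _ hq, codeQ_inv_mul hMc hq, Matrix.fromBlocks_one]

/-- `DD DD' = 1`. [folklore] -/
theorem kD_mul_inv (hq : (q : ℚ) ≠ 0) : DD[(q : ℚ), Mc] * DD'[(q : ℚ), Mc] = 1 := by
  rw [fromBlocks_diag_mul, kDU_mul_inv _ hq, mul_eq_one_comm.mp (codeQ_inv_mul hMc hq),
    Matrix.fromBlocks_one]

/-- `DDᵀ Gfr DD = q · Gfr`: the Kummer shape is a `q`-similitude of the frame lattice `U(2)³ ⊕ ⟨−2⟩¹⁶`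
(`Mcᵀ (−2) Mc = −2q`). [folklore] -/
theorem kD_conj : (DD[(q : ℚ), Mc])ᵀ * Gfr * DD[(q : ℚ), Mc] = (q : ℚ) • Gfr := by
  rw [fromBlocks_diag_conj, kDU_conj, Matrix.mul_smul, Matrix.mul_one, smul_mul_assoc, codeQ_gram hMc,
    smul_comm (-2 : ℚ) (q : ℚ), Matrix.fromBlocks_smul, smul_zero, smul_zero]

end Code

/-- Column `j` of `X Y` is `X` applied to column `j` of `Y`. [folklore] -/
theorem frame_mulVec_col {m n o : Type*} [Fintype n] (X : Matrix m n ℚ) (Y : Matrix n o ℚ) (j : o) :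
    (X *ᵥ fun k => Y k j) = fun i => (X * Y) i j := rfl

/-! ## The stub -/

/-- **Stub 2b — `stub_kummerSimilitude`.** Given a prime `q`, a code matrix `Mc` (`Mcᵀ Mc = q·1`) and
ANY Kummer frame `(u, e)` of `Λ`, there are `ℂ`-linear endomorphisms `M, N` of `Λ_ℂ` with `M`
Kummer-shaped on the frame (`⊕³ diag(1, q)` on `u`, `Mc` on `e`) and `(M, N)` a rational `q`-similitude
pair (`M, N` defined over `ℚ`, `MN = NM = 1`, `(Ma.Mb) = q (a.b)`): `M = F D F⁻¹ ⊗ ℂ`,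
`N = F D⁻¹ F⁻¹ ⊗ ℂ` for the frame matrix `F`, `F⁻¹ = Gfr⁻¹ Fᵀ G`, `D = ⊕³ diag(1, q) ⊕ Mc`. [folklore] -/
theorem stub_kummerSimilitude :
    ∀ q : ℕ, q.Prime → ∀ Mc : Matrix (Fin 16) (Fin 16) ℤ, CodeMatrix[q, Mc] →
      ∀ (u : Fin 3 → Fin 2 → K3Index → ℤ) (e : Fin 16 → K3Index → ℤ), KummerFrame[u, e] →
      ∃ (M N : Module.End ℂ (K3Index → ℂ)),
        KummerShape[q, u, e, Mc, M] ∧ SimilPair[((q : ℕ) : ℂ), M, N] := by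
  intro q hq Mc hMc u e hF
  obtain ⟨hMcMc, -⟩ := hMc
  obtain ⟨hU, hUE, hE, -, -, -⟩ := hF
  have hq0 : (q : ℚ) ≠ 0 := by exact_mod_cast hq.ne_zero
  have hGram : (FF[u, e])ᵀ * Gq * FF[u, e] = Gfr := frame_gram u e hU hUE hE
  have hF'F : FF'[u, e] * FF[u, e] = 1 := frameInv_mul_frame u e hGram
  have hFF' : FF[u, e] * FF'[u, e] = 1 := frame_mul_frameInv u e hGram
  set F' : Matrix JJ K3Index ℚ := FF'[u, e] with hF'
  set A : Matrix K3Index K3Index ℚ := FF[u, e] * DD[(q : ℚ), Mc] * F' with hA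
  set B : Matrix K3Index K3Index ℚ := FF[u, e] * DD'[(q : ℚ), Mc] * F' with hB
  clear_value F' A B
  have h1 : ∀ X : Matrix JJ JJ ℚ, F' * (FF[u, e] * (X * F')) = X * F' := fun X => by
    rw [← Matrix.mul_assoc, hF'F, Matrix.one_mul]
  have h2 : ∀ Y : Matrix JJ K3Index ℚ, DD[(q : ℚ), Mc] * (DD'[(q : ℚ), Mc] * Y) = Y := fun Y => by
    rw [← Matrix.mul_assoc, kD_mul_inv hMcMc hq0, Matrix.one_mul]
  have h3 : ∀ Y : Matrix JJ K3Index ℚ, DD'[(q : ℚ), Mc] * (DD[(q : ℚ), Mc] * Y) = Y := fun Y => by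
    rw [← Matrix.mul_assoc, kDInv_mul hMcMc hq0, Matrix.one_mul]
  have hAB : A * B = 1 := by rw [hA, hB]; simp only [Matrix.mul_assoc, h1, h2, hFF']
  have hBA : B * A = 1 := by rw [hA, hB]; simp only [Matrix.mul_assoc, h1, h3, hFF']
  have hG1 : ∀ X : Matrix JJ K3Index ℚ, (FF[u, e])ᵀ * (Gq * (FF[u, e] * X)) = Gfr * X := fun X => by
    rw [← Matrix.mul_assoc, ← Matrix.mul_assoc, hGram]
  have hG2 : ∀ X : Matrix JJ K3Index ℚ,
      (DD[(q : ℚ), Mc])ᵀ * (Gfr * (DD[(q : ℚ), Mc] * X)) = (q : ℚ) • (Gfr * X) := fun X => by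
    rw [← Matrix.mul_assoc, ← Matrix.mul_assoc, kD_conj hMcMc, Matrix.smul_mul]
  have hG3 : F'ᵀ * (Gfr * F') = Gq := by
    rw [← hGram]
    calc F'ᵀ * ((FF[u, e])ᵀ * Gq * FF[u, e] * F')
          = (FF[u, e] * F')ᵀ * Gq * (FF[u, e] * F') := by
            rw [Matrix.transpose_mul]; simp only [Matrix.mul_assoc]
      _ = Gq := by rw [hFF', Matrix.transpose_one, Matrix.one_mul, Matrix.mul_one]
  have hAconj : Aᵀ * Gq * A = (q : ℚ) • Gq := by
    rw [hA, Matrix.transpose_mul, Matrix.transpose_mul]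
    simp only [Matrix.mul_assoc, hG1, hG2, Matrix.mul_smul, hG3]
  -- the Kummer shape `A F = F D`, read off column by column over `ℚ`
  have hAF : A * FF[u, e] = FF[u, e] * DD[(q : ℚ), Mc] := by
    rw [hA]; simp only [Matrix.mul_assoc, hF'F, Matrix.mul_one]
  rw [Matrix.mul_fromCols, Matrix.fromCols_mul_fromBlocks] at hAF
  simp only [Matrix.mul_zero, add_zero, zero_add] at hAF
  obtain ⟨hAU, hAE⟩ := (Matrix.fromCols_ext_iff _ _ _ _).mp hAF
  have hcolU : ∀ (s : Fin 2) (k : Fin 3), (A *ᵥ fun i => ((u k s i : ℤ) : ℚ)) =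
      fun i => ((u k s i : ℤ) : ℚ) * if s = 0 then 1 else (q : ℚ) := fun s k => by
    have h := frame_mulVec_col A FU[u] (s, k)
    rw [hAU] at h
    refine h.trans (funext fun i => ?_)
    simp [Matrix.mul_diagonal]
  have hcolE : ∀ a : Fin 16, (A *ᵥ fun i => ((e a i : ℤ) : ℚ)) =
      fun i => ∑ b : Fin 16, ((e b i : ℤ) : ℚ) * ((Mc b a : ℤ) : ℚ) := fun a => by
    have h := frame_mulVec_col A FE[e] a
    rw [hAE] at h
    refine h.trans (funext fun i => ?_)
    simp [Matrix.mul_apply]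
  refine ⟨Matrix.toLin' (A.map (Rat.castHom ℂ)), Matrix.toLin' (B.map (Rat.castHom ℂ)),
    ⟨fun k => ⟨?_, ?_⟩, fun a => ?_⟩,
    fun v => ⟨A *ᵥ fun i => (v i : ℚ), ?_⟩, fun v => ⟨B *ᵥ fun i => (v i : ℚ), ?_⟩, ?_, ?_, ?_⟩
  · rw [Matrix.toLin'_apply, intCast_eq_ratCast_intCast (u k 0), ratCast_map_mulVec, hcolU 0 k]
    funext i
    simp
  · rw [Matrix.toLin'_apply, intCast_eq_ratCast_intCast (u k 1), ratCast_map_mulVec, hcolU 1 k]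
    funext i
    simp [mul_comm]
  · rw [Matrix.toLin'_apply, intCast_eq_ratCast_intCast (e a), ratCast_map_mulVec, hcolE a]
    funext i
    simp only [Finset.sum_apply, Pi.smul_apply, smul_eq_mul, Rat.cast_sum, Rat.cast_mul,
      Rat.cast_intCast]
    exact Finset.sum_congr rfl fun b _ => mul_comm _ _
  · rw [Matrix.toLin'_apply, intCast_eq_ratCast_intCast, ratCast_map_mulVec]
  · rw [Matrix.toLin'_apply, intCast_eq_ratCast_intCast, ratCast_map_mulVec]
  · rw [Module.End.mul_eq_comp, ← Matrix.toLin'_mul, ← Matrix.map_mul, hAB,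
      Matrix.map_one _ (map_zero _) (map_one _), Matrix.toLin'_one, Module.End.one_eq_id]
  · rw [Module.End.mul_eq_comp, ← Matrix.toLin'_mul, ← Matrix.map_mul, hBA,
      Matrix.map_one _ (map_zero _) (map_one _), Matrix.toLin'_one, Module.End.one_eq_id]
  · intro x y
    have hG : k3Gram.map (Int.cast : ℤ → ℂ) = (k3Gram.map (Int.cast : ℤ → ℚ)).map (Rat.castHom ℂ) := by
      rw [Matrix.map_map]
      exact Matrix.ext fun i j => by simp
    have hC : (A.map (Rat.castHom ℂ))ᵀ * k3Gram.map (Int.cast : ℤ → ℂ) * A.map (Rat.castHom ℂ) =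
        (q : ℂ) • k3Gram.map (Int.cast : ℤ → ℂ) := by
      rw [hG, ← Matrix.transpose_map, ← Matrix.map_mul, ← Matrix.map_mul, hAconj,
        Matrix.map_smul' _ _ _ (map_mul (Rat.castHom ℂ)), map_natCast]
    rw [Matrix.toLin'_apply, Matrix.toLin'_apply, k3Form_eq_dotProduct, k3Form_eq_dotProduct,
      ← Matrix.vecMul_transpose (A.map _) x]
    simp only [Matrix.dotProduct_mulVec, Matrix.vecMul_vecMul, hC, Matrix.vecMul_smul,
      smul_dotProduct, smul_eq_mul]

end Summit.HodgeConjecture.HodgeConjecture.Theorems.NikulinTwinTransport.KummerBkrQuaternionCarrier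

end
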